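import Summits.BirchSwinnertonDyer.BirchSwinnertonDyer.Theorems.AdditiveBranchIMCGordTwoRankZeroLambdaAdic
import Summits.BirchSwinnertonDyer.BirchSwinnertonDyer.Theorems.AdditiveBranchIMCGordTwoRankZeroLambdaAdicOdd
import HarnessLib

/-!
# Crux `GordTwoRankZeroOffCaseOne` (item 19357): on the tower-surjective irreducible rows in rank `0` the
# three currencies AGREE — Λ-adic branch containment ⟺ `T = 0` lower input ⟺ the lower half of `BSD(E,p)`
# (summary `iff`s; sequel of `AdditiveBranchIMCGordTwoRankZero{Transport,Exact,LambdaAdic,LambdaAdicOdd}`)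

Cell `bsd-addord`, seat `bsd-addord-k1-c2` (D-0074 row B1). HONEST FRAMING: nothing is asserted about any
curve; every published input is an explicit named-fact binder (Kato 17.4 (3) component reading `hK`,
Delbourgo 1998 Prop. 4 in both transcriptions `hDel`/`hDelG`, Pal 2012 Thm. 3.2 `hPal`, GZK, modularity,
`hmodD`); nothing booked. On a pair `(E, p)` of cell (G-ord, `e = 2`) with `E[p]`'s tower
`ρ_{E,p^∞}` surjective and `ord_{s=1} L(E,s) = 0`, the typed PREDICATES
`ChiBranchLowerDivisibility[Odd]At W p` (Λ-adic: `char_Λ X(E/ℚ_∞) ⊆ (ϖ·L_p^{[−]}(f♭, α, ω^{(p−1)/2}, T))`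
for every good ordinary twist datum), `CycLowerLeadingTermAt W p` (`T = 0`) and `MissingLowerBoundAt W p`
(Miller's lower half) are EQUIVALENT — by parity of `(p−1)/2`. So for these rows the crux, its `T = 0`
layer-2 input and the Λ-adic layer-2 input of the route's plan are one statement.

References: K. Kato, Astérisque 295 (2004) Thm. 17.4 (3) [Kato2004Asterisque]; D. Delbourgo, Compositio
Math. 113 (1998) Prop. 4, Main Conjecture p. 151 [Delbourgo1998]; V. Pal, Proc. AMS 140 (2012) Thm. 3.2
[Pal2012]; R. L. Miller, LMS J. Comput. Math. 14 (2011) Def. 1.1 [Miller2011LMS].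
-/

set_option autoImplicit false
set_option linter.dupNamespace false

noncomputable section

open scoped Classical

open WeierstrassCurve NumberField IsDedekindDomain
  Literature.NumberTheory.EllipticCurves
  Literature.NumberTheory.EllipticCurves.ModularForms
  Literature.NumberTheory.EllipticCurves.Rank1Residual
  Literature.NumberTheory.EllipticCurves.Rank1Residual.Typed
  Literature.NumberTheory.GaloisRepresentations

namespace Summit.BirchSwinnertonDyer.BirchSwinnertonDyer.Theorems.AdditiveBranchIMCGordTwoRankZeroLambdaAdicIff

open Summit.BirchSwinnertonDyer.Rank1Residual.Additive
open Summit.BirchSwinnertonDyer.BirchSwinnertonDyer.Theorems.AdditiveBranchIMCGordTwoRankZeroTransport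
open Summit.BirchSwinnertonDyer.BirchSwinnertonDyer.Theorems.AdditiveBranchIMCGordTwoRankZeroExact
open Summit.BirchSwinnertonDyer.BirchSwinnertonDyer.Theorems.AdditiveBranchIMCGordTwoRankZeroLambdaAdic
open Summit.BirchSwinnertonDyer.BirchSwinnertonDyer.Theorems.AdditiveBranchIMCGordTwoRankZeroLambdaAdicOdd

variable {W : WeierstrassCurve ℚ} [W.IsElliptic] [W.IsGloballyMinimal] {p : ℕ} [hp : Fact p.Prime]

/-- **Λ-adic ⟺ `T = 0`, even branch** (`p ≡ 1 (mod 4)`): on a tower-surjective pair of cell (G-ord,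
`e = 2`) in analytic rank `0`, `ChiBranchLowerDivisibilityAt W p ↔ CycLowerLeadingTermAt W p` (Kato `hK`,
Pal `hPal`, modularity, `hmodD`). (→) Mazur–Tate–Teitelbaum constant term + Birch–Pal (Transport file);
(←) the rank-0 upgrade (`chiBranchLowerDivisibility_of_chiBranchLowerLeadingTerm_rankZero_towerSurj`).
[cite: Kato2004Asterisque, Thm. 17.4 (3) (p. 273)] [cite: MazurTateTeitelbaum1986Invent, §I.14] [cite: Pal2012, Thm. 3.2] -/
theorem chiBranchLowerDivisibilityAt_iff_cycLowerLeadingTermAt_rankZero_towerSurj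
    (hK : Kato2004.charIdeal_dvd_padicLFunctionBranch_component_of_surjective)
    (hPal : Pal2012.thm32_sqrt_mul_realPeriodRat_twist_eq_of_prime_one_mod_four)
    (hmod : hasEntireLFunction_rat) (hmodD : nonempty_modularParametrizationData)
    (hc : N10.CellGordTwo W p) (hp1 : p % 4 = 1) (hr : W.analyticRank = 0)
    (htower : ∀ n : ℕ, W.HasSurjectiveModNGaloisRep (p ^ n : ℕ)) :
    ChiBranchLowerDivisibilityAt W p ↔ CycLowerLeadingTermAt W p := by
  have hiff := cycLowerLeadingTermAt_iff_chiBranchLower_of_typeGOrd_of_semistabilityIndex_eq_two W p hPal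
    hmod hmodD hp1 hc.2.1 hc.2.2.1 hc.2.2.2
  constructor
  · intro hΛ
    exact hiff.mpr (chiBranchLowerLeadingTermAt_of_divisibility_of_padicValRat_j_nonneg p W
      (padicValRat_j_nonneg_of_typeGOrd W p hc.2.2.1) hΛ)
  · intro hLow V _ _ κ γ N _ f _ hVW hV hκ hγ hγ' hf D ϖ hϖ g hg
    exact chiBranchLowerDivisibility_of_chiBranchLowerLeadingTerm_rankZero_towerSurj hK hPal hmod hc.2.1
      hc.2.2.1 hr htower (hiff.mp hLow) V hp1 hVW hV hκ hγ hγ' hf D ϖ hϖ g hg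

/-- **Λ-adic ⟺ `T = 0`, odd branch** (`p ≡ 3 (mod 4)`, `p = 3` included): on a tower-surjective pair of
cell (G-ord, `e = 2`) in analytic rank `0`, `ChiBranchLowerDivisibilityOddAt W p ↔ CycLowerLeadingTermAt W p`
(Kato `hK`, modularity, `hmodD`; odd Birch–Pal is a tree theorem).
[cite: Kato2004Asterisque, Thm. 17.4 (3) (p. 273)] [cite: MazurTateTeitelbaum1986Invent, §I.14] [cite: Pal2012, Thm. 3.2] -/
theorem chiBranchLowerDivisibilityOddAt_iff_cycLowerLeadingTermAt_rankZero_towerSurj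
    (hK : Kato2004.charIdeal_dvd_padicLFunctionBranch_component_of_surjective)
    (hmod : hasEntireLFunction_rat) (hmodD : nonempty_modularParametrizationData)
    (hc : N10.CellGordTwo W p) (hp3 : p % 4 = 3) (hr : W.analyticRank = 0)
    (htower : ∀ n : ℕ, W.HasSurjectiveModNGaloisRep (p ^ n : ℕ)) :
    ChiBranchLowerDivisibilityOddAt W p ↔ CycLowerLeadingTermAt W p := by
  have hiff := cycLowerLeadingTermAt_iff_chiBranchLowerOdd_of_typeGOrd_of_semistabilityIndex_eq_two W p
    hmod hmodD hp3 hc.2.1 hc.2.2.1 hc.2.2.2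
  constructor
  · intro hΛ
    exact hiff.mpr (chiBranchLowerLeadingTermOddAt_of_divisibilityOdd_of_padicValRat_j_nonneg p W
      (padicValRat_j_nonneg_of_typeGOrd W p hc.2.2.1) hΛ)
  · intro hLow V _ _ κ γ N _ f _ hVW hV hκ hγ hγ' hf D ϖ hϖ g hg
    exact chiBranchLowerDivisibilityOdd_of_chiBranchLowerLeadingTermOdd_rankZero_towerSurj hK hmod hc.2.1
      hc.2.2.1 hr htower (hiff.mp hLow) V hp3 hVW hV hκ hγ hγ' hf D ϖ hϖ g hg

/-- **Λ-adic ⟺ the lower half of `BSD(E,p)`, even branch**: on a tower-surjective pair of cell (G-ord,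
`e = 2`), `p ≡ 1 (mod 4)`, `r_an = 0`: `ChiBranchLowerDivisibilityAt W p ↔ MissingLowerBoundAt W p`
(through `CycLowerLeadingTermAt` and the Exact file's `missingLowerBoundAt_iff_cycLowerLeadingTermAt_cellGordTwo`:
`hDel`, `hDelG`, GZK). [cite: Kato2004Asterisque, Thm. 17.4 (3) (p. 273)] [cite: Delbourgo1998, Prop. 4 (p. 144)]
[cite: Pal2012, Thm. 3.2] [cite: Miller2011LMS, Def. 1.1] -/
theorem chiBranchLowerDivisibilityAt_iff_missingLowerBoundAt_rankZero_towerSurj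
    (hK : Kato2004.charIdeal_dvd_padicLFunctionBranch_component_of_surjective)
    (hDel : Delbourgo1998.prop4_rankZero_pow_dvd_constantCoeff)
    (hDelG : Delbourgo1998.prop4_rankZero_constantCoeff_eq_unit_mul_of_potGoodOrd)
    (hPal : Pal2012.thm32_sqrt_mul_realPeriodRat_twist_eq_of_prime_one_mod_four)
    (hGZK : rank_eq_analyticRank_of_analyticRank_le_one) (hmod : hasEntireLFunction_rat)
    (hmodD : nonempty_modularParametrizationData)
    (hc : N10.CellGordTwo W p) (hp1 : p % 4 = 1) (hr : W.analyticRank = 0)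
    (htower : ∀ n : ℕ, W.HasSurjectiveModNGaloisRep (p ^ n : ℕ)) :
    ChiBranchLowerDivisibilityAt W p ↔ MissingLowerBoundAt W p :=
  (chiBranchLowerDivisibilityAt_iff_cycLowerLeadingTermAt_rankZero_towerSurj hK hPal hmod hmodD hc hp1 hr
      htower).trans
    (missingLowerBoundAt_iff_cycLowerLeadingTermAt_cellGordTwo hDel hDelG hGZK hmod hc hr).symm

/-- **Λ-adic ⟺ the lower half of `BSD(E,p)`, odd branch** (`p ≡ 3 (mod 4)`, `p = 3` included):
`ChiBranchLowerDivisibilityOddAt W p ↔ MissingLowerBoundAt W p` on a tower-surjective pair of cell (G-ord,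
`e = 2`) with `r_an = 0`. [cite: Kato2004Asterisque, Thm. 17.4 (3) (p. 273)] [cite: Delbourgo1998, Prop. 4 (p. 144)]
[cite: Miller2011LMS, Def. 1.1] -/
theorem chiBranchLowerDivisibilityOddAt_iff_missingLowerBoundAt_rankZero_towerSurj
    (hK : Kato2004.charIdeal_dvd_padicLFunctionBranch_component_of_surjective)
    (hDel : Delbourgo1998.prop4_rankZero_pow_dvd_constantCoeff)
    (hDelG : Delbourgo1998.prop4_rankZero_constantCoeff_eq_unit_mul_of_potGoodOrd)
    (hGZK : rank_eq_analyticRank_of_analyticRank_le_one) (hmod : hasEntireLFunction_rat)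
    (hmodD : nonempty_modularParametrizationData)
    (hc : N10.CellGordTwo W p) (hp3 : p % 4 = 3) (hr : W.analyticRank = 0)
    (htower : ∀ n : ℕ, W.HasSurjectiveModNGaloisRep (p ^ n : ℕ)) :
    ChiBranchLowerDivisibilityOddAt W p ↔ MissingLowerBoundAt W p :=
  (chiBranchLowerDivisibilityOddAt_iff_cycLowerLeadingTermAt_rankZero_towerSurj hK hmod hmodD hc hp3 hr
      htower).trans
    (missingLowerBoundAt_iff_cycLowerLeadingTermAt_cellGordTwo hDel hDelG hGZK hmod hc hr).symm

/-! ## §2 (appended) With `ρ̄_{E,p}` onto in place of the tower: on the `I₀*` cell, mod-`p`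
surjectivity gives the whole tower (Wuthrich 2014 App. B / Greenberg 1991, tree theorem
`forall_hasSurjectiveModNGaloisRep_pow_of_twistModel_goodOrdinary` on the good ordinary twist model), so
the summary iffs hold on X4♯(G-ord, `e = 2`) ∩ surj(`p`) ∩ `r_an = 0` — every odd `p`, `p = 3` included. -/

/-- **Tower from mod-`p` surjectivity on cell (G-ord, `e = 2`)** (every odd `p`, `p = 3` included): if
`ρ̄_{E,p}` is onto then `ρ_{E,pⁿ}` is onto for every `n` — the tree's theorem
`WeierstrassCurve.forall_hasSurjectiveModNGaloisRep_pow_of_twistModel_goodOrdinary` (Greenberg 1991 §2 /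
Wuthrich 2014 App. B: an ordinary twist model forces the `p`-adic image to be full once the mod-`p` image
is) applied to the globally minimal good ordinary model of `E^{(p*)}`
(`TypeGOrd.exists_goodOrd_model_twist_pStar`). [cite: Greenberg1991, §2 (p. 214)]
[cite: SilvermanAEC2009, X.5 Cor. 5.4] -/
theorem towerSurj_of_surj_cellGordTwo (hc : N10.CellGordTwo W p) (hsurj : Surj W p) :
    ∀ n : ℕ, W.HasSurjectiveModNGaloisRep (p ^ n : ℕ) := by
  intro n
  obtain ⟨V, iV, iVm, hWV, hord⟩ :=
    TypeGOrd.exists_goodOrd_model_twist_pStar W p hc.1 hc.2.2.1 hc.2.1 hc.2.2.2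
  exact W.forall_hasSurjectiveModNGaloisRep_pow_of_twistModel_goodOrdinary p hc.1 (pStar_ne_zero p) hWV
    hord.1 hord.2 hsurj n

/-- **X4♯(G-ord, `e = 2`) ∩ surj(`p`) ∩ `r_an = 0`, `p ≡ 1 (mod 4)`: Λ-adic branch containment ⟺ the
lower half of `BSD(E,p)`** — `ChiBranchLowerDivisibilityAt W p ↔ MissingLowerBoundAt W p` with the tower
hypothesis discharged from `Surj W p`. [cite: Kato2004Asterisque, Thm. 17.4 (3) (p. 273)]
[cite: Delbourgo1998, Prop. 4 (p. 144)] [cite: Pal2012, Thm. 3.2] [cite: Miller2011LMS, Def. 1.1] -/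
theorem chiBranchLowerDivisibilityAt_iff_missingLowerBoundAt_rankZero_of_surj
    (hK : Kato2004.charIdeal_dvd_padicLFunctionBranch_component_of_surjective)
    (hDel : Delbourgo1998.prop4_rankZero_pow_dvd_constantCoeff)
    (hDelG : Delbourgo1998.prop4_rankZero_constantCoeff_eq_unit_mul_of_potGoodOrd)
    (hPal : Pal2012.thm32_sqrt_mul_realPeriodRat_twist_eq_of_prime_one_mod_four)
    (hGZK : rank_eq_analyticRank_of_analyticRank_le_one) (hmod : hasEntireLFunction_rat)
    (hmodD : nonempty_modularParametrizationData)
    (hc : N10.CellGordTwo W p) (hp1 : p % 4 = 1) (hr : W.analyticRank = 0) (hsurj : Surj W p) :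
    ChiBranchLowerDivisibilityAt W p ↔ MissingLowerBoundAt W p :=
  chiBranchLowerDivisibilityAt_iff_missingLowerBoundAt_rankZero_towerSurj hK hDel hDelG hPal hGZK hmod hmodD
    hc hp1 hr (towerSurj_of_surj_cellGordTwo hc hsurj)

/-- **X4♯(G-ord, `e = 2`) ∩ surj(`p`) ∩ `r_an = 0`, `p ≡ 3 (mod 4)` (`p = 3` included): Λ-adic odd-branch
containment ⟺ the lower half of `BSD(E,p)`** — `ChiBranchLowerDivisibilityOddAt W p ↔ MissingLowerBoundAt W p`
with the tower hypothesis discharged from `Surj W p`. [cite: Kato2004Asterisque, Thm. 17.4 (3) (p. 273)]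
[cite: Delbourgo1998, Prop. 4 (p. 144)] [cite: Miller2011LMS, Def. 1.1] -/
theorem chiBranchLowerDivisibilityOddAt_iff_missingLowerBoundAt_rankZero_of_surj
    (hK : Kato2004.charIdeal_dvd_padicLFunctionBranch_component_of_surjective)
    (hDel : Delbourgo1998.prop4_rankZero_pow_dvd_constantCoeff)
    (hDelG : Delbourgo1998.prop4_rankZero_constantCoeff_eq_unit_mul_of_potGoodOrd)
    (hGZK : rank_eq_analyticRank_of_analyticRank_le_one) (hmod : hasEntireLFunction_rat)
    (hmodD : nonempty_modularParametrizationData)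
    (hc : N10.CellGordTwo W p) (hp3 : p % 4 = 3) (hr : W.analyticRank = 0) (hsurj : Surj W p) :
    ChiBranchLowerDivisibilityOddAt W p ↔ MissingLowerBoundAt W p :=
  chiBranchLowerDivisibilityOddAt_iff_missingLowerBoundAt_rankZero_towerSurj hK hDel hDelG hGZK hmod hmodD
    hc hp3 hr (towerSurj_of_surj_cellGordTwo hc hsurj)

/-- **Cell form, both parities**: on X4♯(G-ord, `e = 2`) ∩ surj(`p`) in analytic rank `0` (every odd `p`),
the `T = 0` input `CycLowerLeadingTermAt W p` (≡ the crux's conclusion) implies the conclusion of the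
Λ-adic inputs on BOTH branches — `ChiBranchLowerDivisibilityAt W p ∧ ChiBranchLowerDivisibilityOddAt W p`
(each predicate is vacuous off its parity). [cite: Kato2004Asterisque, Thm. 17.4 (3) (p. 273)]
[cite: Pal2012, Thm. 3.2] [cite: MazurTateTeitelbaum1986Invent, §I.14] -/
theorem chiBranchLowerDivisibility_and_odd_of_cycLowerLeadingTerm_rankZero_of_surj
    (hK : Kato2004.charIdeal_dvd_padicLFunctionBranch_component_of_surjective)
    (hPal : Pal2012.thm32_sqrt_mul_realPeriodRat_twist_eq_of_prime_one_mod_four)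
    (hmod : hasEntireLFunction_rat) (hmodD : nonempty_modularParametrizationData)
    (hc : N10.CellGordTwo W p) (hr : W.analyticRank = 0) (hsurj : Surj W p)
    (hLow : CycLowerLeadingTermAt W p) :
    ChiBranchLowerDivisibilityAt W p ∧ ChiBranchLowerDivisibilityOddAt W p := by
  have htower := towerSurj_of_surj_cellGordTwo hc hsurj
  refine ⟨?_, ?_⟩
  · intro V _ _ κ γ N _ f hp1 hVW hV hκ hγ hγ' hf D ϖ hϖ g hg
    exact ((chiBranchLowerDivisibilityAt_iff_cycLowerLeadingTermAt_rankZero_towerSurj hK hPal hmod hmodD hc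
      hp1 hr htower).mpr hLow) V hp1 hVW hV hκ hγ hγ' hf D ϖ hϖ g hg
  · intro V _ _ κ γ N _ f hp3 hVW hV hκ hγ hγ' hf D ϖ hϖ g hg
    exact ((chiBranchLowerDivisibilityOddAt_iff_cycLowerLeadingTermAt_rankZero_towerSurj hK hmod hmodD hc
      hp3 hr htower).mpr hLow) V hp3 hVW hV hκ hγ hγ' hf D ϖ hϖ g hg

end Summit.BirchSwinnertonDyer.BirchSwinnertonDyer.Theorems.AdditiveBranchIMCGordTwoRankZeroLambdaAdicIff

end
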